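import Mathlib
import Summits.ResolutionOfSingularities.ResolutionOfSingularities.Theorems.RadicialJungCleanModelsContactStepIntrinsic
import HarnessLib

/-!
# Route `RadicialJung`, crux `CleanModels` (stmt-ResolutionOfSingularities-15917), line `Sketch` rev 20, stub 4e
# `stub_cleanPrincipalization3`: toward L7b — THE CONTACT DROPS BY ONE (local-algebra package of the point step)

Memo `Cruxes/CleanModels/Lines/Sketch-memo-4e-cleanPermissible.md` rev 11.1, §2.3 phase `(μ,1)` (a) and rev 10 §3 (L7b phase 1): the
engine of the «first cycle» ([CJS 2020] Remark 6.29 / Thm 6.28 Step 5 in the O-architecture of rev 11) is the one-step statement «after blowing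
up the closed point `x` of the regular curve `C`, at the point `c'` of the strict transform `C̃` the contact of `C̃` with the strict transform of a
regular surface `H = V(s)` through `x` is one less».  `ContactStepIntrinsic.lean` (✓ p686719) gave the substitution formula assuming a
factorization `φ(w) = e·w₁`; this file completes the LOCAL-ALGEBRA package the scheme-level typer (work plan W3 / O8) needs, deriving everything
from the three STANDARD outputs of the blowing up of a closed point on a regular curve (all in the tree for transverse regular curves:
`StrictTransformTransverseCurve.lean`, `ColonIdealSheafFG.lean` `IsBlowup.pow_mul_controlledTransform_eq`, `IsBlowup.isEffectiveCartier`):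
  (i) `𝔪_x 𝒪' = (e)` (the exceptional divisor is Cartier at `c'`),  (ii) `𝓘_C 𝒪' ⊆ e · 𝓘_{C̃,c'}` (total transform = exceptional + strict),
  (iii′) `𝓘_{C̃,c'} ⊆ 𝔪_{c'}` and `e` is not a zero divisor,
for a ring map `φ : 𝒪 → 𝒪'` of local rings, `P = 𝓘_{C,x}` with `P + (w) = 𝔪_x` (the curve is regular: `w` restricts to a uniformizer).
* `exists_unit_map_transversal_eq_mul` — (i)+(ii)+(iii′) ⟹ `φ(w) = e · w₁` with `w₁` a UNIT (the hypothesis of `contact_step_intrinsic`; memo rev 10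
  §3 (iii): «else `(e) ⊆ e𝔪'`»).
* `contact_drop` — THE STEP in the normal form adapted to the new point: if `s = γ w^k + π` (`γ` a unit, `π ∈ P`, `k ≥ 1`: contact `k` of `C` with
  `V(s)` at `x`) then `φ(s) = e · s₁` with `s₁ = γ₁ · e^{k−1} + π₁`, `γ₁` a UNIT of `𝒪'`, `π₁ ∈ P'` — the same normal form one level up with respect
  to the pair `(P', e)` (and `P' + (e) = 𝔪_{c'}`: `C̃` is transverse to the exceptional divisor, so `e` restricts to a uniformizer of `C̃`), i.e.
  CONTACT `k − 1`; together with the exponent bookkeeping `φ(u w^A s^a) = (unit) · e^{A+a} · s₁^a` of the clean monomial.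
* `isUnit_contact_drop_one` — at `k = 1` the new `s₁` is a unit: the surface has left the curve.

Honest framing: OURS, elementary algebra; nothing here proves resolution in characteristic `p` or any case of `CleanModels`; the scheme-level
inputs (i)–(iii′) are NOT derived here.
-/

noncomputable section

set_option linter.dupNamespace false -- mandated namespace of this single-conjunct summit

open IsLocalRing

namespace Summit.ResolutionOfSingularities.ResolutionOfSingularities.Theorems.RadicialJung.CleanModels

/-- **The transversal coordinate factors through the exceptional equation with a UNIT cofactor.**  For a ring map `φ : 𝒪 → 𝒪'` into a local
ring, an element `e ∈ 𝒪'` which is not a zero divisor, ideals `P ⊆ 𝒪`, `P' ⊆ 𝔪_{𝒪'}` and `w ∈ 𝒪` with `𝔪 𝒪' = (e)` for `𝔪 := P + (w)` (hypotheses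
`hmle : (P + (w))𝒪' ⊆ (e)` and `he : e ∈ (P + (w))𝒪'`) and `P𝒪' ⊆ e·P'`: `φ(w) = e·w₁` with `w₁` a unit.  Proof: `e = (element of eP') + φ(w)·b`,
`φ(w) = e·a`, so `e(1 − π' − ab) = 0` with `π' ∈ P' ⊆ 𝔪'`; `e` regular forces `ab ≡ 1 (mod 𝔪')`, so `a` is a unit. [folklore] -/
theorem exists_unit_map_transversal_eq_mul {O O' : Type*} [CommRing O] [CommRing O'] [IsLocalRing O'] (φ : O →+* O') (e : O')
    (he0 : e ∈ nonZeroDivisors O') (P : Ideal O) (P' : Ideal O') (hP' : P' ≤ maximalIdeal O') (w : O)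
    (hmle : (P ⊔ Ideal.span {w}).map φ ≤ Ideal.span {e}) (he : e ∈ (P ⊔ Ideal.span {w}).map φ)
    (hPP' : P.map φ ≤ Ideal.span {e} * P') :
    ∃ w₁ : O', IsUnit w₁ ∧ φ w = e * w₁ := by
  -- `φ w ∈ (e)`
  have hw : φ w ∈ Ideal.span {e} := hmle (Ideal.mem_map_of_mem φ (Ideal.mem_sup_right (Ideal.mem_span_singleton_self w)))
  obtain ⟨a, ha⟩ := Ideal.mem_span_singleton'.mp hw
  -- `e ∈ P𝒪' + (φ w) ⊆ e P' + (e a)`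
  rw [Ideal.map_sup, Ideal.map_span, Set.image_singleton] at he
  obtain ⟨q, hq, r, hr, hqr⟩ := Submodule.mem_sup.mp he
  have hq' : q ∈ Ideal.span {e} * P' := hPP' hq
  obtain ⟨π', hπ', hqe⟩ := Ideal.mem_span_singleton_mul.mp hq'
  obtain ⟨b, hb⟩ := Ideal.mem_span_singleton'.mp hr
  -- `e * (1 - π' - b * a) = 0`
  have hkey : e * (1 - π' - b * a) = 0 := by
    have : e = e * π' + b * (a * e) := by rw [hqe, ha, hb]; exact hqr.symm
    linear_combination this
  have hzero : 1 - π' - b * a = 0 :=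
    (mem_nonZeroDivisors_iff.mp he0).1 _ hkey
  -- hence `b * a = 1 - π'` is a unit, so `a` is a unit
  have hba : IsUnit (b * a) := by
    have h1 : b * a = 1 - π' := by linear_combination -hzero
    rw [h1]
    by_contra hnot
    have hmem : 1 - π' ∈ maximalIdeal O' := (mem_maximalIdeal _).mpr hnot
    have h1' := (maximalIdeal O').add_mem hmem (hP' hπ')
    rw [sub_add_cancel] at h1'
    exact (maximalIdeal O').ne_top_iff_one.mp (maximalIdeal.isMaximal O').ne_top h1'
  refine ⟨a, isUnit_of_mul_isUnit_right hba, ?_⟩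
  rw [← ha, mul_comm]

/-- **The contact drops by one.**  Under the inputs (i) `(P + (w))𝒪' = (e)`, (ii) `P𝒪' ⊆ e·P'`, (iii′) `P' ⊆ 𝔪'`, `e` regular, of the blowing up of
the closed point `x` of the regular curve `C = V(P)` read at a point of the strict transform `C̃ = V(P')`: an element in contact normal form
`s = γ w^k + π` (`γ` a unit of `𝒪`, `π ∈ P`, `k ≥ 1`) maps to `φ(s) = e · (γ₁ e^{k−1} + π₁)` with `γ₁` a unit of `𝒪'` and `π₁ ∈ P'` — contact normal
form one level up for the pair `(P', e)`, contact `k − 1` —, and the clean monomial `u w^A s^a` maps to `(φ(u)·(unit)) e^{A+a} (γ₁ e^{k−1} + π₁)^a`.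
[cite: CossartJannsenSaito2020, proof of Thm. 6.28, Step 5] -/
theorem contact_drop {O O' : Type*} [CommRing O] [CommRing O'] [IsLocalRing O] [IsLocalRing O'] (φ : O →+* O') [IsLocalHom φ] (e : O')
    (he0 : e ∈ nonZeroDivisors O') (P : Ideal O) (P' : Ideal O') (hP' : P' ≤ maximalIdeal O') (w : O)
    (hmle : (P ⊔ Ideal.span {w}).map φ ≤ Ideal.span {e}) (he : e ∈ (P ⊔ Ideal.span {w}).map φ)
    (hPP' : P.map φ ≤ Ideal.span {e} * P') (γ u π : O) (hγ : IsUnit γ) (hπ : π ∈ P) (k : ℕ) (hk : 1 ≤ k) (A a : ℕ) :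
    ∃ (γ₁ : O') (_ : IsUnit γ₁) (v₁ : O') (_ : IsUnit v₁) (π₁ : O') (_ : π₁ ∈ P'),
      φ (γ * w ^ k + π) = e * (γ₁ * e ^ (k - 1) + π₁) ∧
        φ (u * w ^ A * (γ * w ^ k + π) ^ a) = (φ u * v₁) * e ^ (A + a) * (γ₁ * e ^ (k - 1) + π₁) ^ a := by
  obtain ⟨w₁, hw₁, hw⟩ := exists_unit_map_transversal_eq_mul φ e he0 P P' hP' w hmle he hPP'
  obtain ⟨π₁, hπ₁, h1, h2⟩ := contact_step_intrinsic φ e w₁ P P' hPP' w γ u π hw hπ k hk A a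
  refine ⟨φ γ * w₁ ^ k, ?_, w₁ ^ A, hw₁.pow A, π₁, hπ₁, ?_, ?_⟩
  · exact (hγ.map φ).mul (hw₁.pow k)
  · rw [h1]
  · rw [h2]

/-- **Contact one ⟹ the surface leaves the curve.**  With the same inputs and `k = 1`, the new local equation `γ₁ e^0 + π₁` of the strict
transform of `V(s)` is a UNIT at the point of `C̃`: after the last step of L7b phase 1 the old component no longer passes through the point of
the curve (and the curve has become transversal to — indeed disjoint from — it there). [folklore] -/
theorem isUnit_contact_drop_one {O' : Type*} [CommRing O'] [IsLocalRing O'] (γ₁ e : O') (hγ₁ : IsUnit γ₁) (P' : Ideal O')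
    (hP' : P' ≤ maximalIdeal O') {π₁ : O'} (hπ₁ : π₁ ∈ P') : IsUnit (γ₁ * e ^ (1 - 1) + π₁) := by
  rw [Nat.sub_self, pow_zero, mul_one]
  by_contra h
  have hm : γ₁ + π₁ ∈ maximalIdeal O' := (mem_maximalIdeal _).mpr h
  have : γ₁ ∈ maximalIdeal O' := by simpa using (maximalIdeal O').sub_mem hm (hP' hπ₁)
  exact (mem_maximalIdeal _).mp this hγ₁

end Summit.ResolutionOfSingularities.ResolutionOfSingularities.Theorems.RadicialJung.CleanModels

end
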